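import Summits.CriticalPhenomena.CardyFormulaZ2.Theorems.CardyIKTransportCornerLineDescentOfInfluenceBounds

/-!
# Rate-free corner irrelevance AT ONE rectangle (`stub_CornerIrrelevanceAt`, crux `CardyIKTransport.CornerLineDescent`)

Support file (`--supports stmt-CriticalPhenomena-10964`, registered sub-goal `stub_CornerIrrelevanceAt`) for the line
`symmetric-seed-second-order` of the crux `CardyIKTransport.CornerLineDescent` (lead c4 reshape: tame rectangles + the
crude-Cardy domain approximation).  THE STUB IS A THEOREM (mechanical, no new mathematics): the summed (dense-window)
and dilute-window influence bounds of the corner seed AT ONE conformal rectangle `R` give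
`gaugeCrossingProb p_IK R δ − gaugeCrossingProb 0 R δ → 0` as `δ → 0⁺` AT `R`.

Proof: the per-rectangle forms of the three landed plumbing lemmas of
`Theorems/CardyIKTransportCornerLineDescentOfInfluenceBounds.lean` (p106570) — `uci_of` (dyadic Russo integration over
`[c₀ δ, p_IK]`, via the elementary `dyadic_sum_bound` reused as is), `regimeOne_of` (linear Russo integration over
`[0, c δ]`) and `endgame_core` (overlap of the two windows at `p = K δ`) — whose proofs use their `∀ R` hypotheses only
at the one rectangle `R` (`obtain … := hsum R`, `hdil R c hc`, `h2 R`, `h1 R`); here they are copied verbatim with the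
hypotheses AT `R` (`uci_at`, `regimeOne_at`, `endgame_at`).  The Margulis–Russo mean-value inequality enters by its
landed name `stub_Russo stub_Locality` (p82972, p80521).

References: route file `Theses/CardyIKTransport.lean` (item 10964); Russo, Z. Wahrsch. 56 (1981) §4; Grimmett,
*Percolation* (1999) Thm 2.25.
-/

noncomputable section

namespace Summit.CriticalPhenomena.CardyFormulaZ2.Theorems.CornerLineDescent.SymmetricSeed

open scoped Topology
open Filter Set
open Literature.Probability.RandomPlanarGeometry

/-! ## §1 The three plumbing lemmas AT ONE rectangle (copies of `uci_of`, `regimeOne_of`, `endgame_core`) -/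

/-- UNIFORM CORNER IRRELEVANCE in units of `ξ_p` AT ONE rectangle `R` (per-`R` form of `uci_of`):
Russo in mean-value form + the summed influence bound at `R`, integrated dyadically in `p`, give
`|P_{p_IK}(R,δ) − P_p(R,δ)| ≤ C' (δ/p)^θ` for `c₀ δ ≤ p ≤ p_IK`, eventually in `δ`. [folklore] -/
theorem uci_at
    (hrusso : ∀ (R : ConformalRectangle) (δ : ℝ), 0 < δ → ∀ p₁ p₂ M : ℝ, 0 ≤ p₁ → p₁ ≤ p₂ → p₂ ≤ 1 →
      RussoLipschitzOn R δ p₁ p₂ M)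
    {R : ConformalRectangle}
    (hsum : ∃ θ C c₀ : ℝ, 0 < θ ∧ 0 < c₀ ∧ ∀ᶠ δ in 𝓝[>] (0:ℝ), InfluenceBoundOn R θ C c₀ δ) :
    ∃ θ C c₀ : ℝ, 0 < θ ∧ 0 < c₀ ∧ ∀ᶠ δ in 𝓝[>] (0:ℝ), ∀ p : ℝ, c₀ * δ ≤ p → p ≤ pIK →
      |gaugeCrossingProb pIK R δ - gaugeCrossingProb p R δ| ≤ C * (δ / p) ^ θ := by
  obtain ⟨θ, C, c₀, hθ, hc₀, hev⟩ := hsum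
  set C' : ℝ := max C 0 with hC'
  have hC'0 : 0 ≤ C' := le_max_right _ _
  refine ⟨θ, C' / (1 - (1 / 2 : ℝ) ^ θ), c₀, hθ, hc₀, ?_⟩
  have hpos : ∀ᶠ δ in 𝓝[>] (0:ℝ), δ ∈ Set.Ioi (0:ℝ) := eventually_mem_nhdsWithin
  filter_upwards [hev, hpos] with δ hδB hδ
  have hδ : 0 < δ := hδ
  intro p hp1 hp2
  have hp : 0 < p := lt_of_lt_of_le (mul_pos hc₀ hδ) hp1
  -- one octave: Russo with the monotone majorant `C' a⁻¹ (δ/a)^θ`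
  have hstep : ∀ a b : ℝ, p ≤ a → a ≤ b → b ≤ pIK → b ≤ 2 * a →
      |gaugeCrossingProb b R δ - gaugeCrossingProb a R δ| ≤ C' * (δ / a) ^ θ := by
    intro a b hpa hab hbq hb2
    have ha : 0 < a := hp.trans_le hpa
    set M : ℝ := C' * a⁻¹ * (δ / a) ^ θ with hM
    have hMnn : 0 ≤ M := by positivity
    have hbound : ∀ s : ℝ, a ≤ s → s ≤ b → influenceSum s R δ ≤ M := by
      intro s has hsb
      have hs : 0 < s := ha.trans_le has
      have h0 := hδB s (hp1.trans (hpa.trans has)) (hsb.trans hbq)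
      have hX1 : s⁻¹ ≤ a⁻¹ := inv_anti₀ ha has
      have hX2 : (δ / s) ^ θ ≤ (δ / a) ^ θ :=
        Real.rpow_le_rpow (by positivity) (div_le_div_of_nonneg_left hδ.le ha has) hθ.le
      calc influenceSum s R δ ≤ C * s⁻¹ * (δ / s) ^ θ := h0
        _ ≤ C' * s⁻¹ * (δ / s) ^ θ := by
            apply mul_le_mul_of_nonneg_right _ (by positivity)
            exact mul_le_mul_of_nonneg_right (le_max_left _ _) (by positivity)
        _ ≤ C' * a⁻¹ * (δ / a) ^ θ := by
            apply mul_le_mul (mul_le_mul_of_nonneg_left hX1 hC'0) hX2 (by positivity) (by positivity)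
    have hr := hrusso R δ hδ a b M ha.le hab (hbq.trans pIK_le_one) hbound
    calc |gaugeCrossingProb b R δ - gaugeCrossingProb a R δ| ≤ M * (b - a) := hr
      _ ≤ M * a := by apply mul_le_mul_of_nonneg_left _ hMnn; linarith
      _ = C' * (δ / a) ^ θ := by rw [hM]; field_simp
  have key := dyadic_sum_bound (fun s => gaugeCrossingProb s R δ) p pIK C' θ δ hp hθ hC'0 hδ.le hp2 hstep
  simpa using key

/-- REGIME ONE AT ONE rectangle `R` (per-`R` form of `regimeOne_of`): Russo in mean-value form + the dilute
influence bound at `R` give, for every window constant `c`, `|P_p(R,δ) − P_0(R,δ)| ≤ ε` for all `p ≤ c δ`,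
eventually in `δ`. [folklore] -/
theorem regimeOne_at
    (hrusso : ∀ (R : ConformalRectangle) (δ : ℝ), 0 < δ → ∀ p₁ p₂ M : ℝ, 0 ≤ p₁ → p₁ ≤ p₂ → p₂ ≤ 1 →
      RussoLipschitzOn R δ p₁ p₂ M)
    {R : ConformalRectangle}
    (hdil : ∀ c : ℝ, 0 < c → ∃ C κ : ℝ, 0 < κ ∧ ∀ᶠ δ in 𝓝[>] (0:ℝ), DiluteBoundOn R c C κ δ)
    (ε : ℝ) (hε : 0 < ε) (c : ℝ) (hc : 0 < c) :
    ∀ᶠ δ in 𝓝[>] (0:ℝ), ∀ p : ℝ, 0 ≤ p → p ≤ c * δ →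
      |gaugeCrossingProb p R δ - gaugeCrossingProb 0 R δ| ≤ ε := by
  obtain ⟨C, κ, hκ, hev⟩ := hdil c hc
  set C' : ℝ := max C 0 with hC'
  have hC'0 : 0 ≤ C' := le_max_right _ _
  have h1 : ∀ᶠ δ in 𝓝[>] (0:ℝ), C' * c * δ ^ κ ≤ ε := by
    have h0 : Tendsto (fun δ : ℝ => δ ^ κ) (𝓝[>] (0:ℝ)) (𝓝 0) := by
      have hcont := (Real.continuousAt_rpow_const 0 κ (Or.inr hκ.le)).tendsto
      rw [Real.zero_rpow hκ.ne'] at hcont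
      exact hcont.mono_left nhdsWithin_le_nhds
    have ht : Tendsto (fun δ : ℝ => C' * c * δ ^ κ) (𝓝[>] (0:ℝ)) (𝓝 0) := by
      simpa using h0.const_mul (C' * c)
    exact ht.eventually_le_const hε
  have h2 : ∀ᶠ δ in 𝓝[>] (0:ℝ), c * δ ≤ 1 := by
    have ht : Tendsto (fun δ : ℝ => c * δ) (𝓝[>] (0:ℝ)) (𝓝 0) := by
      have h0 : Tendsto (fun δ : ℝ => c * δ) (𝓝 (0:ℝ)) (𝓝 (c * 0)) :=
        tendsto_const_nhds.mul tendsto_id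
      rw [mul_zero] at h0
      exact h0.mono_left nhdsWithin_le_nhds
    exact ht.eventually_le_const one_pos
  have h3 : ∀ᶠ δ in 𝓝[>] (0:ℝ), δ ∈ Set.Ioi (0:ℝ) := eventually_mem_nhdsWithin
  filter_upwards [hev, h1, h2, h3] with δ hD hε' hcδ hδ
  have hδ : 0 < δ := hδ
  intro p hp0 hpc
  have hM : ∀ s : ℝ, 0 ≤ s → s ≤ p → influenceSum s R δ ≤ C' * δ ^ (κ - 1) := fun s hs0 hsp =>
    (hD s hs0 (hsp.trans hpc)).trans
      (mul_le_mul_of_nonneg_right (le_max_left _ _) (Real.rpow_nonneg hδ.le _))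
  have hr := hrusso R δ hδ 0 p (C' * δ ^ (κ - 1)) le_rfl hp0 (hpc.trans hcδ) hM
  rw [sub_zero] at hr
  have hpow : δ ^ κ = δ ^ (κ - 1) * δ := by
    rw [Real.rpow_sub_one hδ.ne', div_mul_cancel₀ _ hδ.ne']
  calc |gaugeCrossingProb p R δ - gaugeCrossingProb 0 R δ| ≤ C' * δ ^ (κ - 1) * p := hr
    _ ≤ C' * δ ^ (κ - 1) * (c * δ) := by
        apply mul_le_mul_of_nonneg_left hpc
        exact mul_nonneg hC'0 (Real.rpow_nonneg hδ.le _)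
    _ = C' * c * δ ^ κ := by rw [hpow]; ring
    _ ≤ ε := hε'

/-- THE OVERLAP AT ONE rectangle `R` (per-`R` form of `endgame_core`, logic only): Regime One and uniform corner
irrelevance in units of `ξ_p` meet at `p = K δ` — take `K ≥ c₀` with `C K^{−θ} ≤ ε/2` — so
`|P_IK(R,δ) − P_0(R,δ)| ≤ ε` eventually in `δ`: NO limit object, no interchange of limits. [folklore] -/
theorem endgame_at {R : ConformalRectangle}
    (h1 : ∀ ε : ℝ, 0 < ε → ∀ c : ℝ, 0 < c →
      ∀ᶠ δ in 𝓝[>] (0:ℝ), ∀ p : ℝ, 0 ≤ p → p ≤ c * δ →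
        |gaugeCrossingProb p R δ - gaugeCrossingProb 0 R δ| ≤ ε)
    (h2 : ∃ θ C c₀ : ℝ, 0 < θ ∧ 0 < c₀ ∧
      ∀ᶠ δ in 𝓝[>] (0:ℝ), ∀ p : ℝ, c₀ * δ ≤ p → p ≤ pIK →
        |gaugeCrossingProb pIK R δ - gaugeCrossingProb p R δ| ≤ C * (δ / p) ^ θ)
    (ε : ℝ) (hε : 0 < ε) :
    ∀ᶠ δ in 𝓝[>] (0:ℝ), |gaugeCrossingProb pIK R δ - gaugeCrossingProb 0 R δ| ≤ ε := by
  obtain ⟨θ, C, c₀, hθ, hc₀, hev2⟩ := h2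
  -- window constant `K ≥ c₀` with `C (1/K)^θ ≤ ε/2`
  set M : ℝ := max (2 * C / ε) 1 with hM
  have hM1 : 1 ≤ M := le_max_right _ _
  have hMpos : 0 < M := lt_of_lt_of_le one_pos hM1
  set K₁ : ℝ := M ^ (1 / θ) with hK₁
  have hK₁pos : 0 < K₁ := Real.rpow_pos_of_pos hMpos _
  set K : ℝ := max c₀ K₁ with hK
  have hKpos : 0 < K := lt_of_lt_of_le hc₀ (le_max_left _ _)
  have hK₁le : K₁ ≤ K := le_max_right _ _
  have hc₀le : c₀ ≤ K := le_max_left _ _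
  have hKθ : (1 / K) ^ θ ≤ 1 / M := by
    have h1' : (1 / K) ^ θ ≤ (1 / K₁) ^ θ := by
      apply Real.rpow_le_rpow (by positivity)
      · exact one_div_le_one_div_of_le hK₁pos hK₁le
      · exact hθ.le
    have h2' : (1 / K₁) ^ θ = 1 / M := by
      rw [Real.div_rpow zero_le_one hK₁pos.le, Real.one_rpow, hK₁, ← Real.rpow_mul hMpos.le,
        one_div_mul_cancel hθ.ne', Real.rpow_one]
    exact h1'.trans h2'.le
  have hCK : C * (1 / K) ^ θ ≤ ε / 2 := by
    by_cases hC : C ≤ 0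
    · have h0 : 0 ≤ (1 / K) ^ θ := by positivity
      have : C * (1 / K) ^ θ ≤ 0 := mul_nonpos_of_nonpos_of_nonneg hC h0
      linarith
    · have hC : 0 < C := lt_of_not_ge hC
      have hM2 : 2 * C / ε ≤ M := le_max_left _ _
      calc C * (1 / K) ^ θ ≤ C * (1 / M) := by gcongr
        _ = C / M := by ring
        _ ≤ C / (2 * C / ε) := by
            apply div_le_div_of_nonneg_left hC.le (by positivity) hM2
        _ = ε / 2 := by field_simp
  have hev1 := h1 (ε / 2) (by positivity) K hKpos
  have hsmall : ∀ᶠ δ in 𝓝[>] (0:ℝ), δ ≤ pIK / K := by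
    have : Set.Iio (pIK / K) ∈ 𝓝 (0 : ℝ) := by
      apply Iio_mem_nhds; exact div_pos pIK_pos hKpos
    filter_upwards [nhdsWithin_le_nhds this] with δ hδ using (Set.mem_Iio.1 hδ).le
  have hpos : ∀ᶠ δ in 𝓝[>] (0:ℝ), δ ∈ Set.Ioi (0:ℝ) := eventually_mem_nhdsWithin
  filter_upwards [hev1, hev2, hsmall, hpos] with δ h1δ h2δ h3δ h4δ
  have h4δ : 0 < δ := h4δ
  set p : ℝ := K * δ with hp
  have hppos : 0 < p := mul_pos hKpos h4δ
  have hA := h1δ p hppos.le le_rfl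
  have hplo : c₀ * δ ≤ p := by rw [hp]; exact mul_le_mul_of_nonneg_right hc₀le h4δ.le
  have hphi : p ≤ pIK := by
    rw [hp]; rw [le_div_iff₀ hKpos] at h3δ; linarith
  have hB := h2δ p hplo hphi
  have hδp : δ / p = 1 / K := by
    rw [hp]; field_simp
  rw [hδp] at hB
  have hB' : |gaugeCrossingProb pIK R δ - gaugeCrossingProb p R δ| ≤ ε / 2 := hB.trans hCK
  calc |gaugeCrossingProb pIK R δ - gaugeCrossingProb 0 R δ|
      ≤ |gaugeCrossingProb pIK R δ - gaugeCrossingProb p R δ| +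
          |gaugeCrossingProb p R δ - gaugeCrossingProb 0 R δ| := abs_sub_le _ _ _
    _ ≤ ε / 2 + ε / 2 := add_le_add hB' hA
    _ = ε := by ring

/-! ## §2 The stub -/

/-- Registered stub `stub_CornerIrrelevanceAt` of crux stmt-CriticalPhenomena-10964 (line
`symmetric-seed-second-order`, stub 6, PROVED): THE PER-RECTANGLE FORM OF THE LANDED RUSSO PLUMBING.  The summed and
dilute influence bounds AT ONE rectangle `R` give rate-free corner irrelevance AT `R`:
`gaugeCrossingProb p_IK R δ − gaugeCrossingProb 0 R δ → 0` as `δ → 0⁺`.  Russo (`stub_Russo stub_Locality`, landed)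
turns them into uniform corner irrelevance in units of `ξ_p` (`uci_at`) and Regime One (`regimeOne_at`), which
overlap (`endgame_at`). [folklore] -/
theorem stub_CornerIrrelevanceAt :
    ∀ R : ConformalRectangle,
      (∃ θ C c₀ : ℝ, 0 < θ ∧ 0 < c₀ ∧ ∀ᶠ δ in 𝓝[>] (0:ℝ), InfluenceBoundOn R θ C c₀ δ) →
      (∀ c : ℝ, 0 < c → ∃ C κ : ℝ, 0 < κ ∧ ∀ᶠ δ in 𝓝[>] (0:ℝ), DiluteBoundOn R c C κ δ) →
      Tendsto (fun δ => gaugeCrossingProb pIK R δ - gaugeCrossingProb 0 R δ) (𝓝[>] 0) (𝓝 0) := by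
  intro R hsum hdil
  have hrusso := stub_Russo stub_Locality
  rw [Metric.tendsto_nhds]
  intro ε hε
  filter_upwards [endgame_at (regimeOne_at hrusso hdil) (uci_at hrusso hsum) (ε / 2) (half_pos hε)] with δ hδ
  rw [Real.dist_eq, sub_zero]
  exact lt_of_le_of_lt hδ (half_lt_self hε)

end Summit.CriticalPhenomena.CardyFormulaZ2.Theorems.CornerLineDescent.SymmetricSeed
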